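import Summits.QuantumAdvantage.QuantumAdvantage.Theses.ModularRank
import Literature.Computability.QuantumComplexity.StabilizerRankOver

/-!
# `ModularRankPoly` (stmt-QuantumAdvantage-1792): the recogniser/decomposer × listing split

Crux-strategist file (route `ModularRank`, RESTATED re-audit of the deciding crux, BC2 redirect;
planner-cstrat-stmt-QuantumAdvantage-1792-r1-0, 2026-08-17).

`ModularRankPoly` — "a poly-time oracle `D(1ᵗ,1ᵏ)` lists `≥ k` distinct primes `p ≡ 1 (mod 8)`, each
with a primitive 8th root `r` and a `ZMod p`-stabilizer decomposition of the reduced magic vector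
`x ↦ r^{|x|}` with `≤ (t+k)^c + c` T-free Clifford terms" — is at least as strong as the negated
summit (with `ModularSimulation` it gives `BQP ⊆ P`). This file PROVES the sufficiency of the split
of that oracle into its two debts of different nature:

* `DenseModularDecomposer` (ARITHMETIC, hypothesis-type, consensus-false; cut at the prime):
  `∃ c d P F` — a poly-time recogniser `P t p` of good primes, polynomially DENSE
  (`≥ k` good primes `p ≡ 1 (8)` below `(t+k)^d + d`), and a poly-time per-prime decomposer
  `F t p = (r, L)`, `r⁴ = −1`, `|L| ≤ t^c + c`, `magicVectorOver r t = Σ a • modGateEval r C e₀`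
  over `ZMod p` (the named integral Clifford dictionary of `StabilizerRankOver.lean`).
  NOTE (for refuters): density for ALL `k` at the FIXED span size `t^c + c` forces infinitely many
  cheap primes per `t`, hence — pigeonhole over the finitely many stabilizer directions and the
  minor-norm finiteness behind `ModularRankTransfer` — `χ_ℂ(T^{⊗t}) ≤ t^c + c` for every `t`:
  the piece is killed by `ModularRankSuperpoly` (k = 1) AND by `ExactRankSuperpoly` + transfer.
* `DecomposerListingPolyTime` (COMPLEXITY PLUMBING, theorem-target, TRUE): for every `d`, every
  poly-time `P` and `F` (unary inputs), the listing `(t,k) ↦ [(p, F t p) : p < (t+k)^d + d,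
  p prime, p ≡ 1 (8), P t p]` is `PolyTimeComputable` in the encodings of `ModularRankPoly`.
* `ModularRankPoly_of_subs : DenseModularDecomposer → DecomposerListingPolyTime → ModularRankPoly`
  (hypotheses = the literal child statements filed on the route; conclusion = the route decl by
  name). Proof: the oracle is the listing; polynomial time is piece 2 verbatim; distinct primes
  (`Nodup` of a filtered `range`), `≥ k` blocks (density), and per block: primality / residue /
  root / T-freeness from the recogniser and decomposer, `t^c + c ≤ (t+k)^c + c`, and the identity
  transported from the named dictionary `modGateEval` to the route's inline evaluation GATE BY GATE
  (`smul_prodMap_mulVec_congr` + `cases`; the two agree on T-free words, cf. `modGateEval_eq_inline`).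

Also proved here: `not_denseModularDecomposer_of_superpoly : ModularRankSuperpoly →
¬ DenseModularDecomposer` — the route's kill item (stmt-1793) refutes the arithmetic piece directly
(density at `k = 1`, same exponent), so the designed outcome `refuted:…` survives the split.

What the split deliberately cuts off: `ModularRankPoly` also admits oracles outputting primes of
polynomial BIT-LENGTH found by an unknown deterministic construction; the pieces restrict to primes
of polynomial VALUE (the only regime where a listing can be proved polynomial-time — deterministic
construction of n-bit primes in poly(n) time is itself open — and, by `ModularRankTransfer`, large
primes carry the complex rank anyway).
-/

set_option linter.dupNamespace false

namespace Summit.QuantumAdvantage.QuantumAdvantage.Cruxes.ModularRankPoly.Split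

open Summit.QuantumAdvantage.QuantumAdvantage.Theses.ModularRank

/-- PIECE 1 (crux; hypothesis-type, consensus-false — the arithmetic heart of `ModularRankPoly`,
cut at the prime): cheap-magic primes are polynomially DENSE among small primes, RECOGNISABLE in
polynomial time, and carry UNIFORMLY computable short modular stabilizer decompositions.
`∃ c d P F`: `P t p` (poly-time in unary `(t,p)`) recognises the good primes, at least `k` good
primes `p ≡ 1 (mod 8)` lie below `(t+k)^d + d` for all `t k`, and `F t p = (r, L)` (poly-time in
unary `(t,p)`) returns at every good prime a primitive 8th root `r` (`r⁴ = −1 in ZMod p`) and a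
list `L` of at most `t^c + c` pairs (T-free oracle-free Clifford circuit, coefficient) with
`magicVectorOver r t = Σ_{(C,a) ∈ L} a • modGateEval r C e₀` over `ZMod p`
(`Literature/Computability/QuantumComplexity/StabilizerRankOver.lean`: `x ↦ r^{|x|}` and the
integral Clifford dictionary `√2·H, diag(1,r²), CNOT`). -/
def DenseModularDecomposer : Prop :=
  ∃ c d : ℕ, ∃ P : ℕ → ℕ → Bool, ∃ F : (t : ℕ) → ℕ → ℕ × List (Literature.Computability.Cryptography.QCircuit Literature.Computability.Cryptography.cliffordT t × ℕ), Literature.Computability.Complexity.PolyTimeComputable (fun q : ℕ × ℕ => Literature.Computability.Complexity.boolPair (Computability.unaryEncodeNat q.1) (Computability.unaryEncodeNat q.2)) Computability.encodeBool (fun q => P q.1 q.2) ∧ Literature.Computability.Complexity.PolyTimeComputable (fun q : ℕ × ℕ => Literature.Computability.Complexity.boolPair (Computability.unaryEncodeNat q.1) (Computability.unaryEncodeNat q.2)) (fun o : (Σ t : ℕ, ℕ × List (Literature.Computability.Cryptography.QCircuit Literature.Computability.Cryptography.cliffordT t × ℕ)) => Literature.Computability.Complexity.boolPair (Computability.encodeNat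 o.1) (Literature.Computability.Complexity.boolPair (Computability.encodeNat o.2.1) ((o.2.2.map fun x => Literature.Computability.Complexity.boolPair x.1.encode (Computability.encodeNat x.2)).foldr Literature.Computability.Complexity.boolPair []))) (fun q => ⟨q.1, F q.1 q.2⟩) ∧ (∀ t k : ℕ, k ≤ ((List.range ((t + k) ^ d + d)).filter fun p => decide (p.Prime ∧ p % 8 = 1 ∧ P t p = true)).length) ∧ ∀ t p : ℕ, p.Prime → p % 8 = 1 → P t p = true → ((F t p).1 : ZMod p) ^ 4 = -1 ∧ (F t p).2.length ≤ t ^ c + c ∧ (∀ x ∈ (F t p).2, x.1.IsOracleFree ∧ x.1.tCount = 0) ∧ Literature.Computability.QuantumComplexity.magicVectorOver ((F t p).1 : ZMod p) t = ((F t p).2.map fun x => (x.2 : ZMod p) • (Literature.Computability.QuantumComplexity.modGateEval ((F t p).1 : ZMod p) x.1).mulVec (Pi.single (fun _ => false) 1 : Literature.Computability.Cryptography.QReg t → ZMod p)).sum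

/-- PIECE 2 (theorem-target; TRUE — pure complexity plumbing, no magic): for every exponent `d`,
every poly-time recogniser `P` and every poly-time per-prime map `F` (unary inputs), the listing
`(t,k) ↦ [(p, F t p) : p < (t+k)^d + d, p prime, p ≡ 1 (mod 8), P t p]` is computable in
polynomial time from unary `(t,k)` in the output encoding of `ModularRankPoly` (enumerate the
range, trial division, filter by `P`, map `F` over a poly-length list of poly-bounded unary
arguments, re-encode). -/
def DecomposerListingPolyTime : Prop :=
  ∀ (d : ℕ) (P : ℕ → ℕ → Bool) (F : (t : ℕ) → ℕ → ℕ × List (Literature.Computability.Cryptography.QCircuit Literature.Computability.Cryptography.cliffordT t × ℕ)), Literature.Computability.Complexity.PolyTimeComputable (fun q : ℕ × ℕ => Literature.Computability.Complexity.boolPair (Computability.unaryEncodeNat q.1) (Computability.unaryEncodeNat q.2)) Computability.encodeBool (fun q => P q.1 q.2) → Literature.Computability.Complexity.PolyTimeComputable (fun q : ℕ × ℕ => Literature.Computability.Complexity.boolPair (Computability.unaryEncodeNat q.1) (Computability.unaryEncodeNat q.2)) (fun o : (Σ t : ℕ, ℕ × List (Literature.Computability.Cryptography.QCircuit Literature.Computability.Cryptography.cliffordT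 t × ℕ)) => Literature.Computability.Complexity.boolPair (Computability.encodeNat o.1) (Literature.Computability.Complexity.boolPair (Computability.encodeNat o.2.1) ((o.2.2.map fun x => Literature.Computability.Complexity.boolPair x.1.encode (Computability.encodeNat x.2)).foldr Literature.Computability.Complexity.boolPair []))) (fun q => ⟨q.1, F q.1 q.2⟩) → Literature.Computability.Complexity.PolyTimeComputable (fun q : ℕ × ℕ => Literature.Computability.Complexity.boolPair (Computability.unaryEncodeNat q.1) (Computability.unaryEncodeNat q.2)) (fun o : (Σ t : ℕ, List (ℕ × ℕ × List (Literature.Computability.Cryptography.QCircuit Literature.Computability.Cryptography.cliffordT t × ℕ))) => Literature.Computability.Complexity.boolPair (Computability.encodeNat o.1) ((o.2.map fun b => Literature.Computability.Complexity.boolPair (Computability.encodeNat b.1) (Literature.Computability.Complexity.boolPair (Computability.encodeNat b.2.1) ((b.2.2.map fun x => Literature.Computability.Complexity.boolPair x.1.encode (Computability.encodeNat x.2)).foldr Literature.Computability.Complexity.boolPair []))).foldr Literature.Computability.Complexity.boolPair [])) (fun q => ⟨q.1, ((List.range ((q.1 + q.2) ^ d + d)).filter fun p => decide (p.Prime ∧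 p % 8 = 1 ∧ P q.1 p = true)).map fun p => (p, F q.1 p)⟩)

/-- Congruence helper for the assembly: replacing the gate dictionary `f` by any `g` that agrees
with it on the gates actually occurring in the word does not change `a • (∏ gates) e₀`. -/
theorem smul_prodMap_mulVec_congr {t : ℕ} {R : Type} [CommRing R] (a : R)
    (gates : List (Literature.Computability.Cryptography.QGate Literature.Computability.Cryptography.cliffordT t))
    (f g : Literature.Computability.Cryptography.QGate Literature.Computability.Cryptography.cliffordT t →
      Matrix (Literature.Computability.Cryptography.QReg t) (Literature.Computability.Cryptography.QReg t) R)
    (v : Literature.Computability.Cryptography.QReg t → R) (h : ∀ q ∈ gates, f q = g q) :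
    a • ((gates.map f).reverse.prod).mulVec v = a • ((gates.map g).reverse.prod).mulVec v := by
  rw [List.map_congr_left h]

set_option maxHeartbeats 800000 in
/-- ASSEMBLY (sufficiency of the split): `DenseModularDecomposer → DecomposerListingPolyTime →
ModularRankPoly`. The oracle `D t k` of `ModularRankPoly` is the listing of piece 2 built from the
recogniser/decomposer of piece 1; polynomial time is piece 2 verbatim; distinct primes, `≥ k`
blocks and the per-block clauses are list bookkeeping plus `t^c + c ≤ (t+k)^c + c` and the bridge
`modGateEval_eq_inline` from the named dictionary to the route's inline evaluation. -/
theorem ModularRankPoly_of_subs (h₁ : DenseModularDecomposer) (h₂ : DecomposerListingPolyTime) :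
    ModularRankPoly := by
  obtain ⟨c, d, P, F, hP, hF, hdens, hspec⟩ := h₁
  -- the oracle: list the good primes below the density bound, each with its root and decomposition
  refine ⟨fun t k => ((List.range ((t + k) ^ d + d)).filter fun p => decide (p.Prime ∧ p % 8 = 1 ∧ P t p = true)).map fun p => (p, F t p), ?_, c, fun t k => ⟨?_, ?_, ?_⟩⟩
  · -- polynomial time: piece 2 verbatim
    exact h₂ d P F hP hF
  · -- the listed primes are distinct
    rw [List.map_map]
    have hcomp : (Prod.fst ∘ fun p : ℕ => (p, F t p)) = id := funext fun _ => rfl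
    rw [hcomp, List.map_id]
    exact List.nodup_range.filter _
  · -- at least k blocks: the density clause of piece 1
    rw [List.length_map]
    exact hdens t k
  · -- per-block clauses
    intro b hb
    obtain ⟨p, hp, rfl⟩ := List.mem_map.1 hb
    obtain ⟨-, hp⟩ := List.mem_filter.1 hp
    obtain ⟨hprime, hmod, hgood⟩ := of_decide_eq_true hp
    obtain ⟨hroot, hlen, htf, hid⟩ := hspec t p hprime hmod hgood
    refine ⟨hprime, hmod, hroot, ?_, htf, ?_⟩
    · -- t^c + c ≤ (t+k)^c + c
      calc (F t p).2.length ≤ t ^ c + c := hlen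
        _ ≤ (t + k) ^ c + c := by
          have := Nat.pow_le_pow_left (Nat.le_add_right t k) c
          omega
    · -- the decomposition identity, bridged to the route's inline evaluation gate by gate
      dsimp only
      refine hid.trans (congrArg List.sum (List.map_congr_left fun x hx => ?_))
      have hT := (htf x hx).2
      rw [Literature.Computability.Cryptography.QCircuit.tCount_eq_zero_iff] at hT
      unfold Literature.Computability.QuantumComplexity.modGateEval
      refine smul_prodMap_mulVec_congr _ _ _ _ _ fun q hq => ?_
      cases q with
      | gate g e =>
        cases g
        · rfl
        · rfl
        · exact absurd rfl (hT _ hq e)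
        · rfl
      | oracle k e => rfl

set_option maxHeartbeats 800000 in
/-- THE KILL PATH SURVIVES THE SPLIT: the route's S-side kill item `ModularRankSuperpoly`
(stmt-QuantumAdvantage-1793: for every `c` some `t ≥ 2` at which EVERY prime `p ≡ 1 (mod 8)`, every
root and every modular decomposition need more than `t^c + c` terms) refutes the arithmetic piece
directly — density at `k = 1` supplies one good prime below `(t+1)^d + d`, whose decomposer output
has `≤ t^c + c` terms (same exponent, no juggling; the parent needed `c ↦ 2c`, `SuperpolyKillsPoly`).
So after the split the route still closes `refuted:DenseModularDecomposer` from a Theorems proof of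
`ModularRankSuperpoly`, exactly as designed for the parent. -/
theorem not_denseModularDecomposer_of_superpoly (hS : ModularRankSuperpoly) :
    ¬ DenseModularDecomposer := by
  rintro ⟨c, d, P, F, -, -, hdens, hspec⟩
  obtain ⟨t, -, ht⟩ := hS c
  -- one good prime from density at k = 1
  have hlenpos : 0 < ((List.range ((t + 1) ^ d + d)).filter fun p =>
      decide (p.Prime ∧ p % 8 = 1 ∧ P t p = true)).length := hdens t 1
  obtain ⟨p, hp⟩ := List.exists_mem_of_length_pos hlenpos
  obtain ⟨-, hp⟩ := List.mem_filter.1 hp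
  obtain ⟨hprime, hmod, hgood⟩ := of_decide_eq_true hp
  obtain ⟨hroot, hlen, htf, hid⟩ := hspec t p hprime hmod hgood
  have hsp := ht p hprime hmod ((F t p).1 : ZMod p) hroot
  dsimp only at hsp
  have hL := hsp ((F t p).2.map fun x => (x.1, (x.2 : ZMod p))) ?_ ?_
  · rw [List.length_map] at hL
    omega
  · -- T-freeness is preserved by recasting the coefficients
    intro x hx
    obtain ⟨y, hy, rfl⟩ := List.mem_map.1 hx
    exact htf y hy
  · -- the identity, recast and bridged to the inline evaluation gate by gate
    rw [List.map_map]
    refine hid.trans (congrArg List.sum (List.map_congr_left fun x hx => ?_))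
    simp only [Function.comp_apply]
    have hT := (htf x hx).2
    rw [Literature.Computability.Cryptography.QCircuit.tCount_eq_zero_iff] at hT
    unfold Literature.Computability.QuantumComplexity.modGateEval
    refine smul_prodMap_mulVec_congr _ _ _ _ _ fun q hq => ?_
    cases q with
    | gate g e =>
      cases g
      · rfl
      · rfl
      · exact absurd rfl (hT _ hq e)
      · rfl
    | oracle k e => rfl

end Summit.QuantumAdvantage.QuantumAdvantage.Cruxes.ModularRankPoly.Split
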